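import Summits.AtomisticToContinuum.Crystallization.Theses.NashClassCertificates
import Literature.MathematicalPhysics.StatisticalMechanics.TwoScaleShellSums

/-!
# Separation bootstrap on the Nash class (crux `NashTwoShellGap`, stmt-AtomisticToContinuum-16826,
# line `birth`, stub `stub_nashSeparation`)

STATEMENT. Every `1/3`-separated finite configuration `x` of `ℝ³` that is Nash for `V_LJ` (no particle
lowers its site energy `∑_{k ≠ i} V_LJ(|x_i − x_k|)` by relocating to a point distinct from the other
particles) is `1/2`-separated.

PROOF (removal + packing, the argument of `LennardJonesMinimalDistance_holds` run on the Nash class).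

1. `siteEnergy_nonpos_of_nash`: testing the Nash inequality of particle `i` at the far free point
   `y = c e₀`, `c = 1 + ∑_k ‖x_k‖` (at distance `≥ 1` from every particle, where `V_LJ ≤ 0`) gives
   `siteEnergy x i ≤ 0`.
2. If `|x_i − x_j| < 1/2` for some `j ≠ i`, split the indices `k ≠ i` into NEAR (`|x_i − x_k| < 2`) and
   FAR (`|x_i − x_k| ≥ 2`).
   * `j` is near and `V_LJ(|x_i − x_j|) > 3968/12` (`u = |x_i − x_j|⁻⁶ > 64`, `12 V = u² − 2u > 64 · 62`);
   * the near indices other than `j` number `≤ 13³ − 2 = 2195` (volume packing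
     `card_le_of_separated_of_dist_le` of the `1/3`-separated points `{x_k : |x_i − x_k| < 2} ∋ x_i, x_j`
     of the ball of radius `2` about `x_i`), each contributing `≥ −1/12`;
   * the far ones contribute `≥ −(1/6) ∑_far |x_i − x_k|⁻⁶ ≥ −(1/6) · 250 · 3³ · 2⁻³ = −1687.5/12`
     (`neg_le_lennardJones_of_le` and the two-scale shell sum `sum_inv_pow_six_le_two_scale` with
     separation `1/3` and inner radius `2`).
   Hence `siteEnergy x i > (3968 − 2195 − 1687.5)/12 > 0`, contradicting 1.
-/

noncomputable section

open scoped BigOperators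

namespace Summit.AtomisticToContinuum.Crystallization.Theorems.NashTwoShellGapNashSeparation

open Literature.MathematicalPhysics.StatisticalMechanics

/-- A pair closer than `1/2` is strongly repulsive: `V_LJ(r) > 3968/12` for `0 < r < 1/2`
(`u = r⁻⁶ > 64` and `12 V_LJ(r) = u² − 2u = (u − 64)(u + 62) + 3968`). -/
theorem lt_lennardJones_of_lt_half {r : ℝ} (hr : 0 < r) (hr2 : r < 1 / 2) :
    3968 / 12 < lennardJones r := by
  unfold lennardJones
  have h2 : 2 < r⁻¹ := by
    rw [← one_div, lt_div_iff₀ hr]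
    linarith
  have hu : (64 : ℝ) < (r⁻¹) ^ 6 := by
    calc (64 : ℝ) = 2 ^ 6 := by norm_num
      _ < (r⁻¹) ^ 6 := pow_lt_pow_left₀ h2 (by norm_num) (by norm_num)
  have h12 : (r⁻¹) ^ 12 = ((r⁻¹) ^ 6) ^ 2 := by ring
  rw [h12]
  nlinarith [mul_pos (sub_pos.2 hu) (show (0 : ℝ) < (r⁻¹) ^ 6 + 62 by linarith)]

/-- **Removal inequality on the Nash class.** If particle `i` cannot lower its site energy by
relocating to any point distinct from the other particles, then its site energy is `≤ 0`: relocate it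
to `y = c e₀`, `c = 1 + ∑_k ‖x_k‖`, which is at distance `≥ 1` from every particle, where `V_LJ ≤ 0`
(the far point of `siteEnergy_nonpos_of_isGroundState`). -/
theorem siteEnergy_nonpos_of_nash {N : ℕ} (x : Fin N → EuclideanSpace ℝ (Fin 3)) (i : Fin N)
    (hN : ∀ y : EuclideanSpace ℝ (Fin 3), (∀ j : Fin N, j ≠ i → y ≠ x j) →
      siteEnergy lennardJones x i ≤ ∑ j ∈ Finset.univ.erase i, lennardJones (dist y (x j))) :
    siteEnergy lennardJones x i ≤ 0 := by
  -- adapted from `siteEnergy_nonpos_of_isGroundState` (Literature/.../LennardJonesClusters)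
  set c : ℝ := 1 + ∑ k, ‖x k‖ with hc
  set y : EuclideanSpace ℝ (Fin 3) := EuclideanSpace.single (0 : Fin 3) c with hy_def
  have hc0 : 0 ≤ c := add_nonneg zero_le_one (Finset.sum_nonneg fun k _ => norm_nonneg (x k))
  have hyn : ‖y‖ = c := by simp [hy_def, abs_of_nonneg hc0]
  have hy : ∀ k, 1 ≤ dist y (x k) := fun k => by
    have h1 : ‖x k‖ ≤ ∑ l, ‖x l‖ :=
      Finset.single_le_sum (f := fun l => ‖x l‖) (fun l _ => norm_nonneg _) (Finset.mem_univ k)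
    have h2 : ‖y‖ - ‖x k‖ ≤ dist y (x k) := by rw [dist_eq_norm]; exact norm_sub_norm_le y (x k)
    linarith
  have hy' : ∀ k : Fin N, k ≠ i → y ≠ x k := fun k _ h => by
    have := hy k
    rw [h, dist_self] at this
    exact absurd this (by norm_num)
  have hneg : ∑ k ∈ Finset.univ.erase i, lennardJones (dist y (x k)) ≤ 0 :=
    Finset.sum_nonpos fun k _ => lennardJones_nonpos (hy k)
  exact (hN y hy').trans hneg

/-- **Near count.** In a `1/3`-separated configuration, the indices `k` with `|x_i − x_k| < 2` number at
most `(2 · 2 · 3 + 1)³ = 2197` (volume packing `card_le_of_separated_of_dist_le` in the ball of radius `2`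
about `x_i`; `x` is injective by separation). -/
theorem card_near_le {N : ℕ} {x : Fin N → EuclideanSpace ℝ (Fin 3)}
    (hsep : ∀ i j : Fin N, i ≠ j → 1 / 3 ≤ dist (x i) (x j)) (i : Fin N) (A : Finset (Fin N))
    (hA : ∀ k ∈ A, dist (x i) (x k) < 2) : (A.card : ℝ) ≤ 2197 := by
  classical
  have hinj : Function.Injective x := fun a b hab => by
    by_contra hne
    have := hsep a b hne
    rw [hab, dist_self] at this
    norm_num at this
  rw [← Finset.card_image_of_injective A hinj]
  have h := card_le_of_separated_of_dist_le (A.image x) (x i) (r := 1 / 3) (R := 2)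
    (by norm_num) (by norm_num) ?_ ?_
  · rw [finrank_euclideanSpace_fin] at h
    norm_num at h
    exact_mod_cast h
  · intro c hc
    obtain ⟨k, hk, rfl⟩ := Finset.mem_image.1 hc
    rw [dist_comm]
    exact (hA k hk).le
  · intro c hc c' hc' hne
    obtain ⟨k, -, rfl⟩ := Finset.mem_image.1 hc
    obtain ⟨l, -, rfl⟩ := Finset.mem_image.1 hc'
    exact hsep k l fun h => hne (h ▸ rfl)

/-- **Far tail.** In a `1/3`-separated configuration, the particles at distance `≥ 2` from `x_i`
contribute at least `−(1/6) · 250 · 3³ · 2⁻³ = −1125/8` to its site energy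
(`V_LJ(r) ≥ −r⁻⁶/6` and the two-scale shell sum `sum_inv_pow_six_le_two_scale`). -/
theorem neg_le_sum_far {N : ℕ} {x : Fin N → EuclideanSpace ℝ (Fin 3)}
    (hsep : ∀ i j : Fin N, i ≠ j → 1 / 3 ≤ dist (x i) (x j)) (i : Fin N) (B : Finset (Fin N))
    (hB : ∀ k ∈ B, 2 ≤ dist (x i) (x k)) :
    -(1125 / 8 : ℝ) ≤ ∑ k ∈ B, lennardJones (dist (x i) (x k)) := by
  classical
  have hinj : Function.Injective x := fun a b hab => by
    by_contra hne
    have := hsep a b hne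
    rw [hab, dist_self] at this
    norm_num at this
  have h1 : ∑ k ∈ B, -(1 / 6 * (dist (x i) (x k))⁻¹ ^ 6) ≤
      ∑ k ∈ B, lennardJones (dist (x i) (x k)) :=
    Finset.sum_le_sum fun k hk => neg_le_lennardJones_of_le (by linarith [hB k hk]) le_rfl
  have h2 : ∑ k ∈ B, (dist (x i) (x k))⁻¹ ^ 6 ≤ 250 * (1 / 3 : ℝ)⁻¹ ^ 3 * (2 : ℝ)⁻¹ ^ 3 := by
    rw [← Finset.sum_image (f := fun z => (dist (x i) z)⁻¹ ^ 6) (fun k _ l _ h => hinj h)]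
    refine sum_inv_pow_six_le_two_scale (B.image x) (x i) (by norm_num) (by norm_num) ?_ ?_
    · intro z hz w hw hne
      obtain ⟨k, -, rfl⟩ := Finset.mem_image.1 hz
      obtain ⟨l, -, rfl⟩ := Finset.mem_image.1 hw
      exact hsep k l fun h => hne (h ▸ rfl)
    · intro z hz
      obtain ⟨k, hk, rfl⟩ := Finset.mem_image.1 hz
      exact hB k hk
  rw [Finset.sum_neg_distrib, ← Finset.mul_sum] at h1
  have h3 : (250 * (1 / 3 : ℝ)⁻¹ ^ 3 * (2 : ℝ)⁻¹ ^ 3) = 3375 / 4 := by norm_num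
  rw [h3] at h2
  linarith

/-- **Stub `stub_nashSeparation` of line `birth` (crux `NashTwoShellGap`, stmt-AtomisticToContinuum-16826):
separation bootstrap on the Nash class.** Every `1/3`-separated finite configuration of `ℝ³` that is Nash
for `V_LJ` is `1/2`-separated: if `|x_i − x_j| < 1/2` then the site energy of `i` exceeds
`3968/12 − 2195/12 − 1125/8 > 0` (pair repulsion `lt_lennardJones_of_lt_half`, near count `card_near_le`
with `V_LJ ≥ −1/12`, far tail `neg_le_sum_far`), contradicting the removal inequality
`siteEnergy_nonpos_of_nash`. -/
theorem stub_nashSeparation : ∀ (N : ℕ) (x : Fin N → EuclideanSpace ℝ (Fin 3)), (∀ i j : Fin N, i ≠ j → 1 / 3 ≤ dist (x i) (x j)) → (∀ (i : Fin N) (y : EuclideanSpace ℝ (Fin 3)), (∀ j : Fin N, j ≠ i → y ≠ x j) → Literature.MathematicalPhysics.StatisticalMechanics.siteEnergy Literature.MathematicalPhysics.StatisticalMechanics.lennardJones x i ≤ ∑ j ∈ Finset.univ.erase i, Literature.MathematicalPhysics.StatisticalMechanics.lennardJones (dist y (x j))) → ∀ i j : Fin N, i ≠ j → 1 / 2 ≤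 dist (x i) (x j) := by
  intro N x hsep hnash i j hij
  by_contra hlt
  rw [not_le] at hlt
  classical
  have h0 := siteEnergy_nonpos_of_nash x i (hnash i)
  -- split the site energy of `i` into near and far parts
  have hsplit : siteEnergy lennardJones x i =
      ∑ k ∈ (Finset.univ.erase i).filter (fun k => dist (x i) (x k) < 2),
          lennardJones (dist (x i) (x k)) +
        ∑ k ∈ (Finset.univ.erase i).filter (fun k => ¬ dist (x i) (x k) < 2),
          lennardJones (dist (x i) (x k)) := by
    unfold siteEnergy
    rw [Finset.sum_filter_add_sum_filter_not]
  -- the pair term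
  have hj : j ∈ (Finset.univ.erase i).filter (fun k => dist (x i) (x k) < 2) := by
    rw [Finset.mem_filter]
    exact ⟨Finset.mem_erase.2 ⟨hij.symm, Finset.mem_univ _⟩, by linarith⟩
  have hr0 : 0 < dist (x i) (x j) := by linarith [hsep i j hij]
  have hpair : 3968 / 12 < lennardJones (dist (x i) (x j)) := lt_lennardJones_of_lt_half hr0 hlt
  -- the other near indices number `≤ 2195`
  have hiF : i ∈ Finset.univ.filter (fun k : Fin N => dist (x i) (x k) < 2) := by
    rw [Finset.mem_filter]
    exact ⟨Finset.mem_univ _, by rw [dist_self]; norm_num⟩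
  have hcardF : ((Finset.univ.filter (fun k : Fin N => dist (x i) (x k) < 2)).card : ℝ) ≤ 2197 :=
    card_near_le hsep i _ fun k hk => (Finset.mem_filter.1 hk).2
  have hcard : ((((Finset.univ.erase i).filter (fun k => dist (x i) (x k) < 2)).erase j).card : ℝ)
      ≤ 2195 := by
    have h1 := Finset.card_erase_add_one hj
    have h2 : ((Finset.univ.erase i).filter (fun k => dist (x i) (x k) < 2)).card + 1 =
        (Finset.univ.filter (fun k : Fin N => dist (x i) (x k) < 2)).card := by
      rw [Finset.filter_erase]
      exact Finset.card_erase_add_one hiF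
    have h3 : ((Finset.univ.filter (fun k : Fin N => dist (x i) (x k) < 2)).card : ℝ) =
        (((Finset.univ.erase i).filter (fun k => dist (x i) (x k) < 2)).erase j).card + 2 := by
      rw [← h2, ← h1]
      push_cast
      ring
    linarith
  have hnear : (3968 / 12 - 2195 / 12 : ℝ) <
      ∑ k ∈ (Finset.univ.erase i).filter (fun k => dist (x i) (x k) < 2),
        lennardJones (dist (x i) (x k)) := by
    rw [← Finset.add_sum_erase _ _ hj]
    have h := Finset.sum_le_sum (s := ((Finset.univ.erase i).filter
        (fun k => dist (x i) (x k) < 2)).erase j) (f := fun _ => (-1 / 12 : ℝ))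
      (g := fun k => lennardJones (dist (x i) (x k))) fun k _ => neg_one_div_le_lennardJones _
    rw [Finset.sum_const, nsmul_eq_mul] at h
    linarith
  -- the far tail
  have hfar : -(1125 / 8 : ℝ) ≤
      ∑ k ∈ (Finset.univ.erase i).filter (fun k => ¬ dist (x i) (x k) < 2),
        lennardJones (dist (x i) (x k)) :=
    neg_le_sum_far hsep i _ fun k hk => not_lt.1 (Finset.mem_filter.1 hk).2
  -- assembly
  rw [hsplit] at h0
  linarith

end Summit.AtomisticToContinuum.Crystallization.Theorems.NashTwoShellGapNashSeparation

end
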